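import Mathlib
import Literature.Computability.MetaComplexity.Magnification
import Literature.Computability.MetaComplexity.MCSP
import Literature.Computability.MetaComplexity.MCSPStatisticalTest
import Summits.PneNP.PneNP.Theorems.SoloBlindStreamCollapse
import HarnessLib

/-!
# Sparse languages — in particular `MCSP[s]` — lie in the non-uniform streaming class

Solo seat `solo-PneNP-blind` (blind mode), second audit lemma for the "uniform hardness
magnification" corridor towards `PneNP` (McKay–Murray–Williams, STOC 2019, Thm. 1.3).

1. **Sparse languages stream in small space** (`sparse_hasSpace_decides`, `sparse_mem_STREAM`):
   if for every length `N` the yes-instances of `L` of length `N` lie in a finite set of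
   cardinality `≤ 2 ^ m(N)`, then `L` is decided by a one-pass streaming algorithm (in the sense of
   `Magnification.lean`: arbitrary update maps, one per input length) with space
   `m(N) + size N + 1`: the state records the index of SOME yes-instance extending the prefix read
   so far together with the number of bits read (or a dead flag). By
   `SoloBlind.mem_STREAM_of_hasSpace` it is then in `STREAM S T` for every `S ≥ m + size + 1`,
   `T ≥ 5 S + 10`. [folklore: one-way communication complexity of a sparse set]

2. **`MCSP[s]` is sparse** (`MCSPSize_sparse`, from the circuit count
   `card_filter_circuitSizeOver_le`): at most `2 ^ ((2σ+2)·size(n+σ+1) + 4σ)` truth tables of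
   length `N = 2ⁿ` have circuit complexity `≤ σ = s(n)`. Hence (`MCSPSize_mem_STREAM`,
   `MCSPSize_mem_STREAM_poly`) for every size function with `s(n) ≥ n`,
   `MCSP[s] ∈ STREAM (15 s(⌊log₂ N⌋)² + 4) (75 s(⌊log₂ N⌋)² + 30)`.

Consequence for the corridor: a hypothesis "`MCSP[s] ∉ STREAM (poly s) (poly s)`" typed over the
tree's (non-uniform, unbounded-program) class `STREAM` is FALSE for every `s ≥ id`; the
McKay–Murray–Williams hypothesis is irreducibly a statement about the UNIFORM TIME complexity of
the `poly(s)`-bit update map, on which no information-theoretic (communication / state-counting)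
method has any purchase.

References: D. M. McKay, C. D. Murray, R. R. Williams, *Weak lower bounds on resource-bounded
compression imply strong separations of complexity classes*, STOC 2019, §1.1, §2, Thm. 1.3
[doi:10.1145/3313276.3316396]; S. Arora, B. Barak, *Computational Complexity* (2009), Thm. 6.21
(counting circuits).
-/

namespace Summit.PneNP.PneNP.Theorems

open Literature.Computability.Complexity Literature.Computability.MetaComplexity

namespace SoloBlind

/-! ### Fixed-width binary counters -/

namespace SparseStream

/-- The `W`-bit little-endian binary expansion of `q` (truncated / zero-padded to width `W`).
[folklore] -/
def toBits : ℕ → ℕ → List Bool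
  | 0, _ => []
  | W + 1, q => decide (q % 2 = 1) :: toBits W (q / 2)

/-- The number with the given little-endian binary expansion. [folklore] -/
def ofBits : List Bool → ℕ
  | [] => 0
  | b :: bs => (if b then 1 else 0) + 2 * ofBits bs

/-- `toBits W q` has length exactly `W`. [folklore] -/
@[simp] theorem length_toBits (W q : ℕ) : (toBits W q).length = W := by
  induction W generalizing q with
  | zero => rfl
  | succ W ih => simp [toBits, ih]

/-- Round trip: `ofBits (toBits W q) = q` for `q < 2 ^ W`. [folklore] -/
theorem ofBits_toBits {W q : ℕ} (hq : q < 2 ^ W) : ofBits (toBits W q) = q := by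
  induction W generalizing q with
  | zero => simp [toBits, ofBits]; omega
  | succ W ih =>
    simp only [toBits, ofBits]
    rw [ih (by rw [pow_succ] at hq; omega)]
    rcases Nat.mod_two_eq_zero_or_one q with h | h <;> simp [h] <;> omega

/-! ### The streaming algorithm for a sparse language -/

variable (L : Language Bool) (F : ℕ → Finset (List Bool)) (m : ℕ → ℕ)

/-- The good completions of the prefix `p` at input length `N`: the yes-instances of length `N`
extending `p`. [folklore] -/
def goodSet (N : ℕ) (p : List Bool) : Set (List Bool) := {w | w ∈ L ∧ w.length = N ∧ p <+: w}

/-- The candidate list at input length `N` (a listing of the finite set `F N`). [folklore] -/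
noncomputable def lst (N : ℕ) : List (List Bool) := (F N).toList

open Classical in
/-- The canonical state after reading the prefix `p` at input length `N`: the dead state `[]` if
no candidate is a good completion of `p`, else `true :: ` the `(m N + size N)`-bit code of
`j + 2^{m N} · |p|` where `j` is the index of some good candidate. [folklore] -/
noncomputable def canon (N : ℕ) (p : List Bool) : List Bool :=
  if h : ∃ j, j < (lst F N).length ∧ (lst F N).getD j [] ∈ goodSet L N p then
    true :: toBits (m N + Nat.size N) (Classical.choose h + 2 ^ m N * p.length)
  else []

/-- The update map: decode `(j, i)` from the state, recover the prefix as the first `i` bits of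
candidate `j`, append the new bit and re-canonise; the dead state stays dead. [folklore] -/
noncomputable def upd (N : ℕ) (st : List Bool) (b : Bool) : List Bool :=
  match st with
  | [] => []
  | _ :: bits =>
    canon L F m N
      (((lst F N).getD (ofBits bits % 2 ^ m N) []).take (ofBits bits / 2 ^ m N) ++ [b])

/-- The one-pass streaming algorithm for the sparse language `L` (candidate sets `F`, bit budget
`m`): start in `canon N []`, update by `upd`, accept iff the final state is not dead. [folklore] -/
noncomputable def alg : StreamingAlgorithm where
  init N := canon L F m N []
  update N st b := upd L F m N st b
  accept _ st := decide (st ≠ [])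

variable {L F m}

/-- `canon` in the live case. [folklore] -/
theorem canon_of_pos {N : ℕ} {p : List Bool}
    (h : ∃ j, j < (lst F N).length ∧ (lst F N).getD j [] ∈ goodSet L N p) :
    canon L F m N p =
      true :: toBits (m N + Nat.size N) (Classical.choose h + 2 ^ m N * p.length) := by
  simp only [canon, dif_pos h]

/-- `canon` in the dead case. [folklore] -/
theorem canon_of_neg {N : ℕ} {p : List Bool}
    (h : ¬ ∃ j, j < (lst F N).length ∧ (lst F N).getD j [] ∈ goodSet L N p) :
    canon L F m N p = [] := by
  simp only [canon, dif_neg h]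

/-- Every canonical state has length `≤ m N + size N + 1`. [folklore] -/
theorem length_canon_le (N : ℕ) (p : List Bool) :
    (canon L F m N p).length ≤ m N + Nat.size N + 1 := by
  unfold canon
  split_ifs <;> simp

/-- Every updated state has length `≤ m N + size N + 1` (whatever the input state). [folklore] -/
theorem length_upd_le (N : ℕ) (st : List Bool) (b : Bool) :
    (upd L F m N st b).length ≤ m N + Nat.size N + 1 := by
  cases st with
  | nil => simp [upd]
  | cons a bits => simp only [upd]; exact length_canon_le N _

/-- The algorithm has space `S` for every `S ≥ m + size + 1`. [folklore] -/
theorem hasSpace {S : ℕ → ℕ} (hS : ∀ N, m N + Nat.size N + 1 ≤ S N) :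
    (alg L F m).HasSpace S := fun N =>
  ⟨(length_canon_le (L := L) (F := F) (m := m) N []).trans (hS N),
    fun st b _ => (length_upd_le (L := L) (F := F) (m := m) N st b).trans (hS N)⟩

/-- **Key invariant**: if `|F N| ≤ 2^{m N}`, updating the canonical state of `p` by the bit `b`
gives the canonical state of `p ++ [b]`. [folklore] -/
theorem upd_canon {N : ℕ} (hcard : (F N).card ≤ 2 ^ m N) (p : List Bool) (b : Bool) :
    upd L F m N (canon L F m N p) b = canon L F m N (p ++ [b]) := by
  by_cases h : ∃ j, j < (lst F N).length ∧ (lst F N).getD j [] ∈ goodSet L N p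
  · obtain ⟨hj, hw, hlen, hpre⟩ := Classical.choose_spec h
    have hK : 0 < 2 ^ m N := by positivity
    have hi : p.length ≤ N := hlen ▸ hpre.length_le
    have hjK : Classical.choose h < 2 ^ m N :=
      lt_of_lt_of_le hj (by simpa [lst, Finset.length_toList] using hcard)
    have hq : Classical.choose h + 2 ^ m N * p.length < 2 ^ (m N + Nat.size N) := by
      have h1 : N < 2 ^ Nat.size N := Nat.lt_size_self N
      have h2 : Classical.choose h + 2 ^ m N * p.length < 2 ^ m N * 2 ^ Nat.size N :=
        calc Classical.choose h + 2 ^ m N * p.length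
            < 2 ^ m N + 2 ^ m N * p.length := by omega
          _ = 2 ^ m N * (p.length + 1) := by ring
          _ ≤ 2 ^ m N * 2 ^ Nat.size N := Nat.mul_le_mul_left _ (by omega)
      simpa [pow_add] using h2
    rw [canon_of_pos h]
    simp only [upd]
    rw [ofBits_toBits hq, Nat.add_mul_mod_self_left, Nat.mod_eq_of_lt hjK,
      Nat.add_mul_div_left _ _ hK, Nat.div_eq_of_lt hjK, zero_add,
      ← List.prefix_iff_eq_take.mp hpre]
  · rw [canon_of_neg h]
    simp only [upd]
    symm
    apply canon_of_neg
    rintro ⟨j, hj, hw, hlen, hpre⟩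
    exact h ⟨j, hj, hw, hlen, (List.prefix_append p [b]).trans hpre⟩

/-- Running the algorithm from the canonical state of `p` on `x` reaches the canonical state of
`p ++ x`. [folklore] -/
theorem runFrom_canon {N : ℕ} (hcard : (F N).card ≤ 2 ^ m N) (p x : List Bool) :
    (alg L F m).runFrom N (canon L F m N p) x = canon L F m N (p ++ x) := by
  induction x generalizing p with
  | nil => simp [StreamingAlgorithm.runFrom]
  | cons b x ih =>
    have hstep : (alg L F m).update N (canon L F m N p) b = canon L F m N (p ++ [b]) :=
      upd_canon hcard p b
    simp only [StreamingAlgorithm.runFrom, List.foldl_cons] at ih ⊢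
    rw [hstep, ih, List.append_assoc, List.singleton_append]

/-- If `F N` contains every yes-instance of length `N`, the canonical state of `p` is live iff
some yes-instance of length `N` extends `p`. [folklore] -/
theorem canon_ne_nil_iff {N : ℕ} (hF : ∀ w ∈ L, w.length = N → w ∈ F N) (p : List Bool) :
    canon L F m N p ≠ [] ↔ ∃ w ∈ L, w.length = N ∧ p <+: w := by
  constructor
  · intro hne
    by_cases h : ∃ j, j < (lst F N).length ∧ (lst F N).getD j [] ∈ goodSet L N p
    · obtain ⟨j, -, hw, hlen, hpre⟩ := h
      exact ⟨_, hw, hlen, hpre⟩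
    · exact absurd (canon_of_neg (m := m) h) hne
  · rintro ⟨w, hw, hlen, hpre⟩
    have hmem : w ∈ lst F N := by simpa [lst, Finset.mem_toList] using hF w hw hlen
    obtain ⟨j, hj, hjw⟩ := List.mem_iff_getElem.mp hmem
    have h : ∃ j, j < (lst F N).length ∧ (lst F N).getD j [] ∈ goodSet L N p :=
      ⟨j, hj, by
        rw [List.getD_eq_getElem?_getD, List.getElem?_eq_getElem hj, Option.getD_some, hjw]
        exact ⟨hw, hlen, hpre⟩⟩
    rw [canon_of_pos (m := m) h]
    exact List.cons_ne_nil _ _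

/-- The algorithm decides `L` (given the cardinality bound and the covering property). [folklore] -/
theorem decides (hcard : ∀ N, (F N).card ≤ 2 ^ m N)
    (hF : ∀ N, ∀ w ∈ L, w.length = N → w ∈ F N) : (alg L F m).Decides L := by
  intro x
  have hfin : (alg L F m).finalState x = canon L F m x.length x := by
    show (alg L F m).runFrom x.length (canon L F m x.length []) x = _
    rw [runFrom_canon (hcard _) [] x, List.nil_append]
  simp only [StreamingAlgorithm.Accepts, hfin]
  show decide (canon L F m x.length x ≠ []) = true ↔ x ∈ L
  rw [decide_eq_true_iff, canon_ne_nil_iff (hF _)]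
  constructor
  · rintro ⟨w, hw, hlen, hpre⟩
    have hxw : x = w := hpre.eq_of_length (by omega)
    rw [hxw]
    exact hw
  · intro hx
    exact ⟨x, hx, rfl, List.prefix_rfl⟩

end SparseStream

/-! ### Sparse languages -/

/-- **Sparse languages stream in small space.** If the yes-instances of each length `N` lie in a
finite set of cardinality `≤ 2^{m N}`, then some one-pass streaming algorithm with space `S`
decides `L`, for every `S ≥ m + size + 1`. [folklore] -/
theorem sparse_hasSpace_decides {L : Language Bool} {m : ℕ → ℕ}
    (h : ∀ N, ∃ F : Finset (List Bool), F.card ≤ 2 ^ m N ∧ ∀ w ∈ L, w.length = N → w ∈ F)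
    {S : ℕ → ℕ} (hS : ∀ N, m N + Nat.size N + 1 ≤ S N) :
    ∃ A : StreamingAlgorithm, A.HasSpace S ∧ A.Decides L := by
  choose F hcard hF using h
  exact ⟨SparseStream.alg L F m, SparseStream.hasSpace hS, SparseStream.decides hcard hF⟩

/-- **Sparse languages are in `STREAM S T`** for `S ≥ m + size + 1` and `T ≥ 5 S + 10` (the
time clause is free in the tree's non-uniform model, `mem_STREAM_of_hasSpace`). [folklore] -/
theorem sparse_mem_STREAM {L : Language Bool} {m : ℕ → ℕ}
    (h : ∀ N, ∃ F : Finset (List Bool), F.card ≤ 2 ^ m N ∧ ∀ w ∈ L, w.length = N → w ∈ F)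
    {S T : ℕ → ℕ} (hS : ∀ N, m N + Nat.size N + 1 ≤ S N) (hT : ∀ N, 5 * S N + 10 ≤ T N) :
    L ∈ STREAM S T :=
  mem_STREAM_of_hasSpace (sparse_hasSpace_decides h hS) hT

/-! ### `MCSP[s]` -/

/-- Bit budget for the easy functions: `(2σ+2)·size(n+σ+1) + 4σ`. [folklore] -/
def mcspBits (n σ : ℕ) : ℕ := (2 * σ + 2) * Nat.size (n + σ + 1) + 4 * σ

/-- The circuit count `(σ+1)(16(n+σ+1)²)^σ(n+σ+1)` is at most `2 ^ mcspBits n σ`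
(`n+σ+1 ≤ 2^{size(n+σ+1)}`). [cite: AroraBarak2009, Thm. 6.21] -/
theorem circuitCount_le_two_pow (n σ : ℕ) :
    (σ + 1) * (16 * (n + σ + 1) ^ 2) ^ σ * (n + σ + 1) ≤ 2 ^ mcspBits n σ := by
  unfold mcspBits
  set A := n + σ + 1 with hA
  set a := Nat.size A with ha
  have hA2 : A ≤ 2 ^ a := (Nat.lt_size_self A).le
  have h1 : σ + 1 ≤ 2 ^ a := le_trans (by omega) hA2
  have h2 : 16 * A ^ 2 ≤ 2 ^ (2 * a + 4) :=
    calc 16 * A ^ 2 ≤ 16 * (2 ^ a) ^ 2 := by gcongr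
      _ = 2 ^ (2 * a + 4) := by ring
  have h3 : (16 * A ^ 2) ^ σ ≤ 2 ^ ((2 * a + 4) * σ) := by
    rw [pow_mul]; exact Nat.pow_le_pow_left h2 σ
  calc (σ + 1) * (16 * A ^ 2) ^ σ * A ≤ 2 ^ a * 2 ^ ((2 * a + 4) * σ) * 2 ^ a :=
        Nat.mul_le_mul (Nat.mul_le_mul h1 h3) hA2
    _ = 2 ^ ((2 * σ + 2) * a + 4 * σ) := by rw [← pow_add, ← pow_add]; congr 1; ring

/-- **`MCSP[s]` is sparse**: the yes-instances of length `N` lie in a set of cardinality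
`≤ 2 ^ mcspBits n (s n)`, `n = ⌊log₂ N⌋` (the truth tables of the functions on `n` variables of
circuit complexity `≤ s n`). [cite: AroraBarak2009, Thm. 6.21] -/
theorem MCSPSize_sparse (s : ℕ → ℕ) (N : ℕ) :
    ∃ F : Finset (List Bool), F.card ≤ 2 ^ mcspBits (Nat.log 2 N) (s (Nat.log 2 N)) ∧
      ∀ w ∈ MCSPSize s, w.length = N → w ∈ F := by
  refine ⟨(Finset.univ.filter fun f : (Fin (Nat.log 2 N) → Bool) → Bool =>
      circuitSizeOver B2 f ≤ s (Nat.log 2 N)).image truthTable, ?_, ?_⟩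
  · exact Finset.card_image_le.trans
      ((card_filter_circuitSizeOver_le _ _).trans (circuitCount_le_two_pow _ _))
  · rintro w ⟨n', f, rfl, hf⟩ hlen
    have hn : Nat.log 2 N = n' := by
      rw [← hlen, length_truthTable, Nat.log_pow Nat.one_lt_two]
    subst hn
    exact Finset.mem_image.mpr ⟨f, Finset.mem_filter.mpr ⟨Finset.mem_univ _, hf⟩, rfl⟩

/-- **`MCSP[s] ∈ STREAM S T`** whenever `S N ≥ mcspBits n (s n) + size N + 1` (`n = ⌊log₂ N⌋`)
and `T ≥ 5 S + 10`. [folklore] -/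
theorem MCSPSize_mem_STREAM (s : ℕ → ℕ) {S T : ℕ → ℕ}
    (hS : ∀ N, mcspBits (Nat.log 2 N) (s (Nat.log 2 N)) + Nat.size N + 1 ≤ S N)
    (hT : ∀ N, 5 * S N + 10 ≤ T N) : MCSPSize s ∈ STREAM S T :=
  sparse_mem_STREAM (m := fun N => mcspBits (Nat.log 2 N) (s (Nat.log 2 N)))
    (MCSPSize_sparse s) hS hT

/-- Arithmetic: for `n ≤ σ` and `size N ≤ n + 1`, `mcspBits n σ + size N + 1 ≤ 15 σ² + 4`.
[folklore] -/
theorem mcspBits_bound {n σ N : ℕ} (hn : n ≤ σ) (hN : Nat.size N ≤ n + 1) :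
    mcspBits n σ + Nat.size N + 1 ≤ 15 * σ ^ 2 + 4 := by
  unfold mcspBits
  have hsz : Nat.size (n + σ + 1) ≤ n + σ + 1 := Nat.size_le.mpr (Nat.lt_two_pow_self)
  have h1 : (2 * σ + 2) * Nat.size (n + σ + 1) ≤ (2 * σ + 2) * (2 * σ + 1) :=
    Nat.mul_le_mul_left _ (hsz.trans (by omega))
  have h2 : σ ≤ σ ^ 2 := by nlinarith
  nlinarith

/-- **Headline.** For every size function with `s(n) ≥ n`:
`MCSP[s] ∈ STREAM (15·s(⌊log₂N⌋)² + 4) (75·s(⌊log₂N⌋)² + 30)` — the tree-typed form of the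
McKay–Murray–Williams streaming hypothesis ("`MCSP[s]` has no `poly(s)`-space `poly(s)`-time
one-pass streaming algorithm") is false in the non-uniform model. [folklore] -/
theorem MCSPSize_mem_STREAM_poly (s : ℕ → ℕ) (hs : ∀ n, n ≤ s n) :
    MCSPSize s ∈ STREAM (fun N => 15 * s (Nat.log 2 N) ^ 2 + 4)
      (fun N => 75 * s (Nat.log 2 N) ^ 2 + 30) := by
  refine MCSPSize_mem_STREAM s (fun N => ?_) (fun N => by omega)
  have hN : Nat.size N ≤ Nat.log 2 N + 1 :=
    Nat.size_le.mpr (Nat.lt_pow_succ_log_self Nat.one_lt_two N)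
  exact mcspBits_bound (hs _) hN

/-- Arithmetic for the polynomial envelope: `75 σ² + 30 ≤ σ^105 + 105`. [folklore] -/
theorem poly_envelope (σ : ℕ) : 75 * σ ^ 2 + 30 ≤ σ ^ 105 + 105 := by
  rcases Nat.lt_or_ge σ 2 with h | h
  · interval_cases σ <;> norm_num
  · have h7 : 2 ^ 7 ≤ σ ^ 7 := Nat.pow_le_pow_left h 7
    have h9 : σ ^ 9 ≤ σ ^ 105 := Nat.pow_le_pow_right (by omega) (by norm_num)
    have hsq : 4 ≤ σ ^ 2 := by nlinarith
    have h9' : σ ^ 9 = σ ^ 2 * σ ^ 7 := by ring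
    nlinarith

/-- **The non-uniform reading of the McKay–Murray–Williams hypothesis is false.** Reading
"`MCSP[s]` is not solvable by a `poly(s(n))`-space streaming algorithm with `poly(s(n))` update
time" (STOC 2019, Thm. 1.3) over the tree's class `STREAM` — i.e. `MCSP[s] ∉ STREAM S T` for ALL
`S, T ≤ s(⌊log₂N⌋)^c + c` — is refuted for every `s` with `s(n) ≥ n`: some such `S, T` (exponent
`c = 105`, from `15σ²+4`, `75σ²+30`) have `MCSP[s] ∈ STREAM S T`. Hence any typing of Thm. 1.3
must bound the SIZE (uniformity) of the update machines, and no information-theoretic argument can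
prove its hypothesis. [folklore] -/
theorem nonuniform_streamingLowerBound_false (s : ℕ → ℕ) (hs : ∀ n, n ≤ s n) :
    ∃ S T : ℕ → ℕ,
      (∀ N, S N ≤ s (Nat.log 2 N) ^ 105 + 105 ∧ T N ≤ s (Nat.log 2 N) ^ 105 + 105) ∧
      MCSPSize s ∈ STREAM S T := by
  refine ⟨_, _, fun N => ⟨?_, poly_envelope _⟩, MCSPSize_mem_STREAM_poly s hs⟩
  have := poly_envelope (s (Nat.log 2 N))
  omega

end SoloBlind

end Summit.PneNP.PneNP.Theorems
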